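import Literature.Geometry.Symplectic.SurfaceTubeRetraction
import Literature.Geometry.Manifold.InjOnNhdsOfCompact
import Literature.Topology.FourManifolds.InverseFunctionTheorem
import HarnessLib

/-!
# Tubular charts of a symplectic surface: injectivity of `(π₁, nrm)` and local box charts

Topic `Literature/Geometry/Symplectic`; layer C2c of the construction of the symplectic tubular
neighbourhood with its `U(1)`-structure of a closed symplectic surface `b : S → N` in a
symplectic `4`-manifold (McLean, GAFA 2012, **Lemma 5.14**, `k = 1`; McDuff–Salamon 2017,
Thm. 3.4.10), for the fact seat of
`Literature.Geometry.Symplectic.mclean_divisorComplement_convex_four`.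

With the corrected retraction `π₁` and the normal coordinate `nrm` of
`SurfaceTubeRetraction.lean` (`D : Setup N S V`, `S` compact):

* `Setup.Θ x = (π₁ x, nrm x)`: injective on an open neighbourhood `N₂` of the surface
  (`injOn_Θ`; Hirsch's "an immersion injective on a compact set is injective on a
  neighbourhood", via `InjOnNhdsOfCompact.lean`);
* local orthonormal frames `un c y, jn c y = J (un c y)` of the normal planes `F y` near a
  point where `Q y c ≠ 0`, the frame maps `Fr c y : ℝ² →L V` and coordinates `ζ c y : V →L ℝ²`
  (`Fr_ζ`, `ζ_Fr`, `norm_Fr`, smoothness);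
* the **tubular box charts** (`BoxChart`, `exists_boxChart`): around each point `b y₀` of the
  surface the map `Ξ x = (φ (π₁ x), ζ (π₁ x) (nrm x))` (`φ` the chart of `S` at `y₀`) is a
  diffeomorphism of an open set `O ∋ b y₀` onto a box `ball (φ y₀) δ × ball 0 ρ ⊆ ℝ² × ℝ²`
  (inverse function theorem on manifolds, `isLocalDiffeomorphAt_of_mfderiv`), in which
  `π₁ = φ⁻¹ ∘ pr₁` and `nrm = Fr ∘ pr₂` (`BoxChart.π₁_inv`, `BoxChart.nrm_inv`,
  `BoxChart.exists_mem_Θ_eq`): the surface is `{z = 0}`, the fibres of `π₁` are the `z`-discs,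
  and `‖nrm‖ = ‖z‖`.

Everything here is proved; no named facts (D-0026).

## References

* M. McLean, *The growth rate of symplectic homology and affine varieties*, GAFA 22 (2012),
  Lemma 5.14, pp. 35–37 (arXiv:1011.2542). [Mclean2012]
* D. McDuff, D. Salamon, *Introduction to Symplectic Topology*, 3rd ed. (2017), Thm. 3.4.10.
  [McDuffSalamon2017]
* M. W. Hirsch, *Differential Topology* (1976), Ch. 4 §5, Thms. 5.1–5.2; Ch. 2 §1 Ex. 7.
  [HirschDT1976]
* J. M. Lee, *Introduction to Smooth Manifolds*, 2nd ed. (2013), Thm. 4.5. [LeeSmoothManifolds2013]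
-/

noncomputable section

open scoped Manifold ContDiff Topology RealInnerProductSpace
open Set Function Module Filter Metric
open Literature.Topology.FourManifolds
open Literature.Geometry.Kaehler
open Literature.Geometry.Manifold

namespace Literature.Geometry.Symplectic

namespace SurfaceTube

/-- Local notation for the model plane. -/
local notation "E2" => EuclideanSpace ℝ (Fin 2)

variable {N : Type*} [TopologicalSpace N] [ChartedSpace (EuclideanSpace ℝ (Fin 4)) N]
  [IsManifold (𝓡 4) ∞ N] {S : Type*} [TopologicalSpace S] [ChartedSpace (EuclideanSpace ℝ (Fin 2)) S]
  [IsManifold (𝓡 2) ∞ S] {V : Type*} [NormedAddCommGroup V] [InnerProductSpace ℝ V]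
  [FiniteDimensional ℝ V] (D : Setup N S V)

namespace Setup

/-! ### Local orthonormal frames of the normal planes -/

section Frame

variable (c : V)

/-- The unit normal `un c y = Q y c / ‖Q y c‖` (meaningful where `Q y c ≠ 0`). [folklore] -/
def un (y : S) : V := ‖D.Q y c‖⁻¹ • D.Q y c

/-- The second frame vector `jn c y = J y (un c y)`. [folklore] -/
def jn (y : S) : V := D.J y (D.un c y)

/-- `un ∈ F`. [folklore] -/
theorem un_mem_F (y : S) : D.un c y ∈ D.F y := (D.F y).smul_mem _ (D.Q_apply_mem y c)

/-- `Q un = un`. [folklore] -/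
theorem Q_un (y : S) : D.Q y (D.un c y) = D.un c y := D.Q_apply_eq_self_iff.2 (D.un_mem_F c y)

/-- `jn ∈ F`. [folklore] -/
theorem jn_mem_F (y : S) : D.jn c y ∈ D.F y := D.J_apply_mem y _

/-- `Q jn = jn`. [folklore] -/
theorem Q_jn (y : S) : D.Q y (D.jn c y) = D.jn c y := D.Q_apply_eq_self_iff.2 (D.jn_mem_F c y)

/-- `J un = jn`. [folklore] -/
theorem J_un (y : S) : D.J y (D.un c y) = D.jn c y := rfl

/-- `J jn = -un`. [folklore] -/
theorem J_jn (y : S) : D.J y (D.jn c y) = -D.un c y := by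
  rw [jn, J_J_apply, Q_un]

variable {c}

/-- `‖un‖ = 1`. [folklore] -/
theorem norm_un {y : S} (h : D.Q y c ≠ 0) : ‖D.un c y‖ = 1 := by
  rw [un, norm_smul, norm_inv, norm_norm, inv_mul_cancel₀ (norm_ne_zero_iff.2 h)]

/-- `‖jn‖ = 1`. [folklore] -/
theorem norm_jn {y : S} (h : D.Q y c ≠ 0) : ‖D.jn c y‖ = 1 := by
  rw [jn, norm_J, Q_un, D.norm_un h]

variable (c)

/-- `⟪jn, un⟫ = 0`. [folklore] -/
theorem inner_jn_un (y : S) : ⟪D.jn c y, D.un c y⟫ = 0 := D.inner_J_self y _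

/-- `⟪un, jn⟫ = 0`. [folklore] -/
theorem inner_un_jn (y : S) : ⟪D.un c y, D.jn c y⟫ = 0 := by
  rw [real_inner_comm, inner_jn_un]

variable {c}

/-- `⟪un, un⟫ = 1`. [folklore] -/
theorem inner_un_un {y : S} (h : D.Q y c ≠ 0) : ⟪D.un c y, D.un c y⟫ = 1 := by
  rw [real_inner_self_eq_norm_sq, D.norm_un h, one_pow]

/-- `⟪jn, jn⟫ = 1`. [folklore] -/
theorem inner_jn_jn {y : S} (h : D.Q y c ≠ 0) : ⟪D.jn c y, D.jn c y⟫ = 1 := by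
  rw [real_inner_self_eq_norm_sq, D.norm_jn h, one_pow]

variable (c)

/-- The set where the frame is defined is open. [folklore] -/
theorem isOpen_frameDom : IsOpen {y : S | D.Q y c ≠ 0} :=
  isOpen_ne_fun (D.continuous_Q.clm_apply continuous_const) continuous_const

/-- `y ↦ un c y` is smooth where `Q y c ≠ 0`. [folklore] -/
theorem contMDiffOn_un : ContMDiffOn (𝓡 2) 𝓘(ℝ, V) ∞ (D.un c) {y | D.Q y c ≠ 0} := by
  intro y hy
  have h1 : ContMDiffAt (𝓡 2) 𝓘(ℝ, V) ∞ (fun y ↦ D.Q y c) y := (D.contMDiff_Q.clm_apply contMDiff_const) y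
  have h2 : ContMDiffAt (𝓡 2) 𝓘(ℝ, ℝ) ∞ (fun y ↦ ‖D.Q y c‖) y :=
    ContDiffAt.comp_contMDiffAt (x := y) (f := fun y ↦ D.Q y c) (contDiffAt_norm ℝ hy) h1
  exact ((h2.inv₀ (norm_ne_zero_iff.2 hy)).smul h1).contMDiffWithinAt

/-- `y ↦ jn c y` is smooth where `Q y c ≠ 0`. [folklore] -/
theorem contMDiffOn_jn : ContMDiffOn (𝓡 2) 𝓘(ℝ, V) ∞ (D.jn c) {y | D.Q y c ≠ 0} :=
  D.contMDiff_J.contMDiffOn.clm_apply (D.contMDiffOn_un c)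

/-- The linear map `w ↦ (z ↦ zᵢ • w)`. [folklore] -/
def frameL (i : Fin 2) : V →L[ℝ] (E2 →L[ℝ] V) :=
  ContinuousLinearMap.smulRightL ℝ E2 V (EuclideanSpace.proj i)

omit [FiniteDimensional ℝ V] in
/-- `frameL i w z = zᵢ • w`. [folklore] -/
theorem frameL_apply (i : Fin 2) (w : V) (z : E2) : frameL (V := V) i w z = z i • w := rfl

/-- The linear map `u ↦ (w ↦ ⟪u, w⟫ eᵢ)`. [folklore] -/
def coordL (i : Fin 2) : V →L[ℝ] (V →L[ℝ] E2) :=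
  ((ContinuousLinearMap.smulRightL ℝ V E2).flip (EuclideanSpace.single i (1 : ℝ))).comp
    (innerSL ℝ)

omit [FiniteDimensional ℝ V] in
/-- `coordL i u w = ⟪u, w⟫ • eᵢ`. [folklore] -/
theorem coordL_apply (i : Fin 2) (u w : V) :
    coordL (V := V) i u w = ⟪u, w⟫ • EuclideanSpace.single i (1 : ℝ) := rfl

/-- **The frame map** `Fr c y : ℝ² →L V`, `z ↦ z₀ un + z₁ jn`. [folklore] -/
def Fr (y : S) : E2 →L[ℝ] V := frameL 0 (D.un c y) + frameL 1 (D.jn c y)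

/-- **The frame coordinates** `ζ c y : V →L ℝ²`, `w ↦ (⟪un, w⟫, ⟪jn, w⟫)`. [folklore] -/
def ζ (y : S) : V →L[ℝ] E2 := coordL 0 (D.un c y) + coordL 1 (D.jn c y)

/-- `Fr z = z₀ un + z₁ jn`. [folklore] -/
theorem Fr_apply (y : S) (z : E2) : D.Fr c y z = z 0 • D.un c y + z 1 • D.jn c y := rfl

/-- `ζ w = ⟪un, w⟫ e₀ + ⟪jn, w⟫ e₁`. [folklore] -/
theorem ζ_apply (y : S) (w : V) :
    D.ζ c y w = ⟪D.un c y, w⟫ • EuclideanSpace.single 0 (1 : ℝ) +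
      ⟪D.jn c y, w⟫ • EuclideanSpace.single 1 (1 : ℝ) := rfl

/-- The coordinates of `ζ w`. [folklore] -/
theorem ζ_apply_zero (y : S) (w : V) : D.ζ c y w 0 = ⟪D.un c y, w⟫ := by
  simp [ζ_apply]

/-- The coordinates of `ζ w`. [folklore] -/
theorem ζ_apply_one (y : S) (w : V) : D.ζ c y w 1 = ⟪D.jn c y, w⟫ := by
  simp [ζ_apply]

/-- `Fr z ∈ F`. [folklore] -/
theorem Fr_mem_F (y : S) (z : E2) : D.Fr c y z ∈ D.F y :=
  (D.F y).add_mem ((D.F y).smul_mem _ (D.un_mem_F c y)) ((D.F y).smul_mem _ (D.jn_mem_F c y))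

/-- `Q (Fr z) = Fr z`. [folklore] -/
theorem Q_Fr (y : S) (z : E2) : D.Q y (D.Fr c y z) = D.Fr c y z :=
  D.Q_apply_eq_self_iff.2 (D.Fr_mem_F c y z)

/-- **`J` acts on the frame coordinates as the rotation by `+π/2`**:
`J (Fr z) = Fr (-z₁, z₀)`, i.e. `J (z₀ un + z₁ jn) = -z₁ un + z₀ jn`. [folklore] -/
theorem J_Fr (y : S) (z : E2) : D.J y (D.Fr c y z) = (-z 1) • D.un c y + z 0 • D.jn c y := by
  rw [Fr_apply, map_add, map_smul, map_smul, J_un, J_jn, smul_neg, add_comm, neg_smul]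

variable {c}

/-- **`ζ ∘ Fr = id`.** [folklore] -/
theorem ζ_Fr {y : S} (h : D.Q y c ≠ 0) (z : E2) : D.ζ c y (D.Fr c y z) = z := by
  ext i
  fin_cases i
  · simp [ζ_apply, Fr_apply, inner_add_right, inner_smul_right, D.norm_un h, D.inner_un_jn c y]
  · simp [ζ_apply, Fr_apply, inner_add_right, inner_smul_right, D.norm_jn h, D.inner_jn_un c y]

/-- **`‖Fr z‖ = ‖z‖`**: the frame map is an isometry. [folklore] -/
theorem norm_Fr {y : S} (h : D.Q y c ≠ 0) (z : E2) : ‖D.Fr c y z‖ = ‖z‖ := by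
  have h1 : ‖D.Fr c y z‖ ^ 2 = z 0 ^ 2 + z 1 ^ 2 := by
    rw [← real_inner_self_eq_norm_sq, Fr_apply, inner_add_left, inner_add_right, inner_add_right,
      real_inner_smul_left, real_inner_smul_left, real_inner_smul_right, real_inner_smul_right,
      real_inner_smul_left, real_inner_smul_left, real_inner_smul_right, real_inner_smul_right,
      D.inner_un_un h, D.inner_jn_jn h, D.inner_un_jn c y, D.inner_jn_un c y]
    ring
  have h2 : ‖z‖ ^ 2 = z 0 ^ 2 + z 1 ^ 2 := by
    rw [EuclideanSpace.norm_sq_eq, Fin.sum_univ_two, Real.norm_eq_abs, Real.norm_eq_abs, sq_abs,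
      sq_abs]
  exact (sq_eq_sq₀ (norm_nonneg _) (norm_nonneg _)).1 (h1.trans h2.symm)

/-- **`Fr ∘ ζ = id` on the normal plane**: `un, jn` form an orthonormal basis of the plane `F y`.
[folklore] -/
theorem Fr_ζ {y : S} (h : D.Q y c ≠ 0) {w : V} (hw : w ∈ D.F y) : D.Fr c y (D.ζ c y w) = w := by
  -- the orthonormal pair `(un, jn)` in the `2`-plane `F y` is a basis
  let v : Fin 2 → D.F y := ![⟨D.un c y, D.un_mem_F c y⟩, ⟨D.jn c y, D.jn_mem_F c y⟩]
  have hv : Orthonormal ℝ v := by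
    rw [orthonormal_iff_ite]
    intro i j
    fin_cases i <;> fin_cases j
    · exact D.inner_un_un h
    · exact D.inner_un_jn c y
    · exact D.inner_jn_un c y
    · exact D.inner_jn_jn h
  have hcard : Fintype.card (Fin 2) = finrank ℝ (D.F y) := by rw [D.finrank_F]; simp
  let bs : OrthonormalBasis (Fin 2) ℝ (D.F y) :=
    (basisOfOrthonormalOfCardEqFinrank hv hcard).toOrthonormalBasis
      (by simpa using hv)
  have hbs : ∀ i, bs i = v i := fun i ↦ by simp [bs]
  have hsum := bs.sum_repr' ⟨w, hw⟩
  rw [Fin.sum_univ_two, hbs, hbs] at hsum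
  have hsum' := congrArg Subtype.val hsum
  simp only [Submodule.coe_add, Submodule.coe_smul, v, Matrix.cons_val_zero, Matrix.cons_val_one] at hsum'
  rw [Fr_apply, ζ_apply_zero, ζ_apply_one]
  exact hsum'

/-- `‖ζ w‖ = ‖w‖` on the normal plane. [folklore] -/
theorem norm_ζ {y : S} (h : D.Q y c ≠ 0) {w : V} (hw : w ∈ D.F y) : ‖D.ζ c y w‖ = ‖w‖ := by
  conv_rhs => rw [← D.Fr_ζ h hw]
  rw [D.norm_Fr h]

/-- `ζ` is injective on the normal plane. [folklore] -/
theorem ζ_eq_zero_iff {y : S} (h : D.Q y c ≠ 0) {w : V} (hw : w ∈ D.F y) : D.ζ c y w = 0 ↔ w = 0 := by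
  rw [← norm_eq_zero, D.norm_ζ h hw, norm_eq_zero]

variable (c)

/-- `y ↦ Fr c y` is smooth where the frame is defined. [folklore] -/
theorem contMDiffOn_Fr : ContMDiffOn (𝓡 2) 𝓘(ℝ, E2 →L[ℝ] V) ∞ (D.Fr c) {y | D.Q y c ≠ 0} :=
  ((frameL (V := V) 0).contMDiff.comp_contMDiffOn (D.contMDiffOn_un c)).add
    ((frameL (V := V) 1).contMDiff.comp_contMDiffOn (D.contMDiffOn_jn c))

/-- `y ↦ ζ c y` is smooth where the frame is defined. [folklore] -/
theorem contMDiffOn_ζ : ContMDiffOn (𝓡 2) 𝓘(ℝ, V →L[ℝ] E2) ∞ (D.ζ c) {y | D.Q y c ≠ 0} :=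
  ((coordL (V := V) 0).contMDiff.comp_contMDiffOn (D.contMDiffOn_un c)).add
    ((coordL (V := V) 1).contMDiff.comp_contMDiffOn (D.contMDiffOn_jn c))

/-- **There is a frame seed at every point**: some `c` with `Q y c ≠ 0` (`dim F y = 2`).
[folklore] -/
theorem exists_Q_ne_zero (y : S) : ∃ c : V, D.Q y c ≠ 0 := by
  have hpos : 0 < finrank ℝ (D.F y) := by rw [D.finrank_F]; norm_num
  obtain ⟨m, hm⟩ := finrank_pos_iff_exists_ne_zero.1 hpos
  refine ⟨m, ?_⟩
  rw [D.Q_apply_eq_self_iff.2 m.2]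
  exact fun h0 ↦ hm (Subtype.ext h0)

end Frame

/-! ### The map `Θ = (π₁, nrm)` and its injectivity near the surface -/

section Theta

variable [CompactSpace S] [Nonempty S]

/-- **`Θ x = (π₁ x, nrm x)`**: foot point and normal coordinate. [folklore] -/
def Θ (x : N) : S × V := (D.π₁ x, D.nrm x)

/-- Unfolding of `Θ`. [folklore] -/
theorem Θ_apply (x : N) : D.Θ x = (D.π₁ x, D.nrm x) := rfl

/-- `Θ (b y) = (y, 0)`. [folklore] -/
theorem Θ_b (y : S) : D.Θ (D.b y) = (y, 0) := Prod.ext (D.π₁_b y) (D.nrm_b y)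

/-- `Θ` is continuous at the points of `N₁`. [folklore] -/
theorem continuousAt_Θ {x : N} (hx : x ∈ D.N₁) : ContinuousAt D.Θ x :=
  (D.contMDiffAt_π₁ hx).continuousAt.prodMk (D.contMDiffAt_nrm hx).continuousAt

/-- `Θ` is injective on the surface. [folklore] -/
theorem injOn_Θ_range_b : InjOn D.Θ (range D.b) := by
  rintro _ ⟨y, rfl⟩ _ ⟨y', rfl⟩ h
  have h1 := congrArg Prod.fst h
  rw [Θ_b, Θ_b] at h1
  exact congrArg D.b h1

/-- Equality of `Θ` is equality of both components. [folklore] -/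
theorem Θ_eq_iff {x x' : N} : D.Θ x = D.Θ x' ↔ D.π₁ x = D.π₁ x' ∧ D.nrm x = D.nrm x' :=
  Prod.ext_iff

/-- **`Θ` is injective on a neighbourhood of each point of the surface** (its differential is
injective there: inverse function theorem / uniform Taylor expansion).
[cite: HirschDT1976, Ch. 2 §1 Lemma 1.3] -/
theorem exists_nhds_injOn_Θ (y₀ : S) : ∃ U ∈ 𝓝 (D.b y₀), InjOn D.Θ U := by
  -- the auxiliary map into the vector space `ℝ² × V`
  let Θ' : N → E2 × V := fun x ↦ (extChartAt (𝓡 2) y₀ (D.π₁ x), D.nrm x)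
  have hx₀ : D.b y₀ ∈ D.N₁ := D.b_mem_N₁ y₀
  have hπ : ContMDiffAt (𝓡 4) (𝓡 2) ∞ D.π₁ (D.b y₀) := D.contMDiffAt_π₁ hx₀
  have hφ : ContMDiffAt (𝓡 2) 𝓘(ℝ, E2) ∞ (extChartAt (𝓡 2) y₀) (D.π₁ (D.b y₀)) := by
    rw [D.π₁_b]; exact contMDiffAt_extChartAt
  have h1 : ContMDiffAt (𝓡 4) 𝓘(ℝ, E2) ∞ (fun x ↦ extChartAt (𝓡 2) y₀ (D.π₁ x)) (D.b y₀) :=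
    hφ.comp (D.b y₀) hπ
  have h2 : ContMDiffAt (𝓡 4) 𝓘(ℝ, V) ∞ D.nrm (D.b y₀) := D.contMDiffAt_nrm hx₀
  have hΘ' : ContMDiffAt (𝓡 4) 𝓘(ℝ, E2 × V) ∞ Θ' (D.b y₀) := h1.prodMk_space h2
  -- its differential is injective
  have hmφ : MDifferentiableAt (𝓡 2) 𝓘(ℝ, E2) (extChartAt (𝓡 2) y₀) (D.π₁ (D.b y₀)) :=
    hφ.mdifferentiableAt (by simp)
  have hd1 : HasMFDerivAt (𝓡 4) 𝓘(ℝ, E2) (fun x ↦ extChartAt (𝓡 2) y₀ (D.π₁ x)) (D.b y₀)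
      ((mfderiv (𝓡 2) 𝓘(ℝ, E2) (extChartAt (𝓡 2) y₀) (D.π₁ (D.b y₀))).comp (D.dπ₁ (D.b y₀))) :=
    hmφ.hasMFDerivAt.comp (D.b y₀) (D.mdifferentiableAt_π₁ hx₀).hasMFDerivAt
  have hd2 : HasMFDerivAt (𝓡 4) 𝓘(ℝ, V) D.nrm (D.b y₀) (D.dnrm (D.b y₀)) :=
    (D.mdifferentiableAt_nrm hx₀).hasMFDerivAt
  have hd : HasMFDerivAt (𝓡 4) 𝓘(ℝ, E2 × V) Θ' (D.b y₀)
      (((mfderiv (𝓡 2) 𝓘(ℝ, E2) (extChartAt (𝓡 2) y₀) (D.π₁ (D.b y₀))).comp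
        (D.dπ₁ (D.b y₀))).prod (D.dnrm (D.b y₀))) :=
    ⟨hd1.1.prodMk hd2.1, hd1.2.prodMk hd2.2⟩
  have hφinj : Injective (mfderiv (𝓡 2) 𝓘(ℝ, E2) (extChartAt (𝓡 2) y₀) (D.π₁ (D.b y₀))) := by
    rw [D.π₁_b]
    exact (isInvertible_mfderiv_extChartAt (mem_extChartAt_source y₀)).injective
  have hinj : Injective (mfderiv (𝓡 4) 𝓘(ℝ, E2 × V) Θ' (D.b y₀)) := by
    rw [hd.mfderiv]
    refine (injective_iff_map_eq_zero _).2 fun v hv ↦ ?_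
    have hv1 : mfderiv (𝓡 2) 𝓘(ℝ, E2) (extChartAt (𝓡 2) y₀) (D.π₁ (D.b y₀)) (D.dπ₁ (D.b y₀) v) = 0 :=
      congrArg Prod.fst hv
    have h2' : D.dnrm (D.b y₀) v = 0 := congrArg Prod.snd hv
    have h1' : D.dπ₁ (D.b y₀) v = 0 := hφinj (hv1.trans (map_zero _).symm)
    exact D.eq_zero_of_dπ₁_eq_zero_of_dnrm_eq_zero y₀ v h1' h2'
  obtain ⟨U, hU, hUinj⟩ := exists_mem_nhds_injOn_of_injective_mfderiv hΘ' (by simp) hinj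
  refine ⟨U, hU, fun x hx x' hx' h ↦ hUinj hx hx' ?_⟩
  obtain ⟨h1, h2⟩ := D.Θ_eq_iff.1 h
  show (extChartAt (𝓡 2) y₀ (D.π₁ x), D.nrm x) = (extChartAt (𝓡 2) y₀ (D.π₁ x'), D.nrm x')
  rw [h1, h2]

variable [T2Space S]

/-- **`Θ` is injective on an open neighbourhood of the (compact) surface** — the tubular
neighbourhood is embedded (Hirsch, Ch. 4 §5 Thm. 5.1). [cite: HirschDT1976, Ch. 4 §5 Thm. 5.1] -/
theorem exists_isOpen_injOn_Θ :
    ∃ O : Set N, IsOpen O ∧ range D.b ⊆ O ∧ O ⊆ D.N₁ ∧ InjOn D.Θ O := by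
  have hK : IsCompact (range D.b) := isCompact_range D.hb.continuous
  obtain ⟨O, hO, hKO, hinj⟩ := D.injOn_Θ_range_b.exists_isOpen_superset hK
    (by rintro _ ⟨y, rfl⟩; exact D.continuousAt_Θ (D.b_mem_N₁ y))
    (by rintro _ ⟨y, rfl⟩; exact D.exists_nhds_injOn_Θ y)
  exact ⟨O ∩ D.N₁, hO.inter D.isOpen_N₁,
    subset_inter hKO (by rintro _ ⟨y, rfl⟩; exact D.b_mem_N₁ y), inter_subset_right,
    hinj.mono inter_subset_left⟩

/-- **The embedded tube domain `N₂ ⊆ N₁`**: an open neighbourhood of the surface on which `Θ` is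
injective. [folklore] -/
def N₂ : Set N := D.exists_isOpen_injOn_Θ.choose

/-- The defining properties of `N₂`. [folklore] -/
theorem N₂_spec : IsOpen D.N₂ ∧ range D.b ⊆ D.N₂ ∧ D.N₂ ⊆ D.N₁ ∧ InjOn D.Θ D.N₂ :=
  D.exists_isOpen_injOn_Θ.choose_spec

/-- `N₂` is open. [folklore] -/
theorem isOpen_N₂ : IsOpen D.N₂ := D.N₂_spec.1

/-- The surface lies in `N₂`. [folklore] -/
theorem b_mem_N₂ (y : S) : D.b y ∈ D.N₂ := D.N₂_spec.2.1 ⟨y, rfl⟩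

/-- `N₂ ⊆ N₁`. [folklore] -/
theorem N₂_subset_N₁ : D.N₂ ⊆ D.N₁ := D.N₂_spec.2.2.1

/-- **`Θ` is injective on `N₂`.** [cite: HirschDT1976, Ch. 4 §5 Thm. 5.1] -/
theorem injOn_Θ : InjOn D.Θ D.N₂ := D.N₂_spec.2.2.2

end Theta

/-! ### The tubular box charts -/

section Chart

variable [CompactSpace S] [Nonempty S] [T2Space S] (y₀ : S) (c : V)

/-- **The chart map** `Ξ x = (φ (π₁ x), ζ (π₁ x) (nrm x)) ∈ ℝ² × ℝ²` (`φ` the chart of `S` at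
`y₀`, `ζ` the frame coordinates for the seed `c`). [folklore] -/
def Ξ (x : N) : E2 × E2 := (extChartAt (𝓡 2) y₀ (D.π₁ x), D.ζ c (D.π₁ x) (D.nrm x))

/-- The domain of the chart map: points of `N₂` retracting into the chart domain of `y₀` and
the frame domain. [folklore] -/
def Ξdom : Set N := D.N₂ ∩ D.π₁ ⁻¹' ((extChartAt (𝓡 2) y₀).source ∩ {y | D.Q y c ≠ 0})

omit [T2Space S] in
/-- Unfolding of `Ξ`. [folklore] -/
theorem Ξ_apply (x : N) :
    D.Ξ y₀ c x = (extChartAt (𝓡 2) y₀ (D.π₁ x), D.ζ c (D.π₁ x) (D.nrm x)) := rfl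

/-- `Ξdom ⊆ N₂`. [folklore] -/
theorem Ξdom_subset_N₂ : D.Ξdom y₀ c ⊆ D.N₂ := inter_subset_left

/-- `Ξdom ⊆ N₁`. [folklore] -/
theorem Ξdom_subset_N₁ : D.Ξdom y₀ c ⊆ D.N₁ := (D.Ξdom_subset_N₂ y₀ c).trans D.N₂_subset_N₁

/-- The chart domain is open. [folklore] -/
theorem isOpen_Ξdom : IsOpen (D.Ξdom y₀ c) :=
  (D.contMDiffOn_π₁.mono D.N₂_subset_N₁).continuousOn.isOpen_inter_preimage D.isOpen_N₂
    ((isOpen_extChartAt_source y₀).inter (D.isOpen_frameDom c))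

variable {y₀ c}

/-- Points of the chart domain retract into the chart domain of `y₀`. [folklore] -/
theorem π₁_mem_source_of_mem_Ξdom {x : N} (hx : x ∈ D.Ξdom y₀ c) :
    D.π₁ x ∈ (extChartAt (𝓡 2) y₀).source := hx.2.1

/-- Points of the chart domain retract into the frame domain. [folklore] -/
theorem Q_π₁_ne_zero_of_mem_Ξdom {x : N} (hx : x ∈ D.Ξdom y₀ c) : D.Q (D.π₁ x) c ≠ 0 := hx.2.2

/-- The base point lies in the chart domain (for a seed `c` with `Q y₀ c ≠ 0`). [folklore] -/
theorem b_mem_Ξdom (hc : D.Q y₀ c ≠ 0) : D.b y₀ ∈ D.Ξdom y₀ c := by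
  refine ⟨D.b_mem_N₂ y₀, ?_⟩
  show D.π₁ (D.b y₀) ∈ (extChartAt (𝓡 2) y₀).source ∩ {y | D.Q y c ≠ 0}
  rw [D.π₁_b]
  exact ⟨mem_extChartAt_source y₀, hc⟩

omit [T2Space S] in
/-- `Ξ (b y₀) = (φ y₀, 0)`. [folklore] -/
theorem Ξ_b : D.Ξ y₀ c (D.b y₀) = (extChartAt (𝓡 2) y₀ y₀, 0) := by
  rw [Ξ_apply, D.nrm_b, map_zero, D.π₁_b]

variable (y₀ c)

/-- **The chart map is smooth on its domain.** [folklore] -/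
theorem contMDiffOn_Ξ : ContMDiffOn (𝓡 4) 𝓘(ℝ, E2 × E2) ∞ (D.Ξ y₀ c) (D.Ξdom y₀ c) := by
  have hπ : ContMDiffOn (𝓡 4) (𝓡 2) ∞ D.π₁ (D.Ξdom y₀ c) := D.contMDiffOn_π₁.mono (D.Ξdom_subset_N₁ y₀ c)
  have h1 : ContMDiffOn (𝓡 4) 𝓘(ℝ, E2) ∞ (fun x ↦ extChartAt (𝓡 2) y₀ (D.π₁ x)) (D.Ξdom y₀ c) := by
    refine contMDiffOn_extChartAt.comp hπ fun x hx ↦ ?_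
    rw [← extChartAt_source (𝓡 2)]
    exact hx.2.1
  have h2 : ContMDiffOn (𝓡 4) 𝓘(ℝ, V →L[ℝ] E2) ∞ (fun x ↦ D.ζ c (D.π₁ x)) (D.Ξdom y₀ c) :=
    (D.contMDiffOn_ζ c).comp hπ fun x hx ↦ hx.2.2
  have h3 : ContMDiffOn (𝓡 4) 𝓘(ℝ, V) ∞ D.nrm (D.Ξdom y₀ c) :=
    D.contMDiffOn_nrm.mono (D.Ξdom_subset_N₁ y₀ c)
  exact h1.prodMk_space (h2.clm_apply h3)

/-- The differential of the chart map at the base point (as a map `T_{b y₀} N →L ℝ² × ℝ²`):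
`v ↦ (dφ (dπ₁ v), ζ (Q (de v)))`. [folklore] -/
def dΞ : TangentSpace (𝓡 4) (D.b y₀) →L[ℝ] E2 × E2 :=
  ((mfderiv (𝓡 2) 𝓘(ℝ, E2) (extChartAt (𝓡 2) y₀) (D.π₁ (D.b y₀))).comp (D.dπ₁ (D.b y₀))).prod
    ((D.ζ c y₀).comp (D.dnrm (D.b y₀)))

variable {y₀ c}

omit [T2Space S] in
/-- **The chart map has differential `dΞ` at the base point.** [folklore] -/
theorem hasMFDerivAt_Ξ (hc : D.Q y₀ c ≠ 0) :
    HasMFDerivAt (𝓡 4) 𝓘(ℝ, E2 × E2) (D.Ξ y₀ c) (D.b y₀) (D.dΞ y₀ c) := by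
  have hx₀ : D.b y₀ ∈ D.N₁ := D.b_mem_N₁ y₀
  have hπ : ContMDiffAt (𝓡 4) (𝓡 2) ∞ D.π₁ (D.b y₀) := D.contMDiffAt_π₁ hx₀
  have hφ : ContMDiffAt (𝓡 2) 𝓘(ℝ, E2) ∞ (extChartAt (𝓡 2) y₀) (D.π₁ (D.b y₀)) := by
    rw [D.π₁_b]; exact contMDiffAt_extChartAt
  have hmφ : MDifferentiableAt (𝓡 2) 𝓘(ℝ, E2) (extChartAt (𝓡 2) y₀) (D.π₁ (D.b y₀)) :=
    hφ.mdifferentiableAt (by simp)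
  have hd1 : HasMFDerivAt (𝓡 4) 𝓘(ℝ, E2) (fun x ↦ extChartAt (𝓡 2) y₀ (D.π₁ x)) (D.b y₀)
      ((mfderiv (𝓡 2) 𝓘(ℝ, E2) (extChartAt (𝓡 2) y₀) (D.π₁ (D.b y₀))).comp (D.dπ₁ (D.b y₀))) :=
    hmφ.hasMFDerivAt.comp (D.b y₀) (D.mdifferentiableAt_π₁ hx₀).hasMFDerivAt
  -- the second component by the product rule at the zero `nrm (b y₀) = 0`
  have hζdom : {y : S | D.Q y c ≠ 0} ∈ 𝓝 (D.π₁ (D.b y₀)) := by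
    rw [D.π₁_b]; exact (D.isOpen_frameDom c).mem_nhds hc
  have hg : MDifferentiableAt (𝓡 4) 𝓘(ℝ, V →L[ℝ] E2) (fun x ↦ D.ζ c (D.π₁ x)) (D.b y₀) :=
    (((D.contMDiffOn_ζ c).contMDiffAt hζdom).mdifferentiableAt (by simp)).comp (D.b y₀)
      (D.mdifferentiableAt_π₁ hx₀)
  have hf : MDifferentiableAt (𝓡 4) 𝓘(ℝ, V) D.nrm (D.b y₀) := D.mdifferentiableAt_nrm hx₀
  have hmd2 : MDifferentiableAt (𝓡 4) 𝓘(ℝ, E2) (fun x ↦ D.ζ c (D.π₁ x) (D.nrm x)) (D.b y₀) :=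
    hg.clm_apply hf
  have heq : mfderiv (𝓡 4) 𝓘(ℝ, E2) (fun x ↦ D.ζ c (D.π₁ x) (D.nrm x)) (D.b y₀) =
      (D.ζ c y₀).comp (D.dnrm (D.b y₀)) := by
    ext v
    rw [mfderiv_clm_apply_of_eq_zero hg hf (D.nrm_b y₀) v]
    show D.ζ c (D.π₁ (D.b y₀)) (D.dnrm (D.b y₀) v) = D.ζ c y₀ (D.dnrm (D.b y₀) v)
    rw [D.π₁_b]
  have hd2 : HasMFDerivAt (𝓡 4) 𝓘(ℝ, E2) (fun x ↦ D.ζ c (D.π₁ x) (D.nrm x)) (D.b y₀)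
      ((D.ζ c y₀).comp (D.dnrm (D.b y₀))) := heq ▸ hmd2.hasMFDerivAt
  exact ⟨hd1.1.prodMk hd2.1, hd1.2.prodMk hd2.2⟩

omit [T2Space S] in
/-- **The differential of the chart map at the base point is injective.** [folklore] -/
theorem injective_dΞ (hc : D.Q y₀ c ≠ 0) : Injective (D.dΞ y₀ c) := by
  have hφinj : Injective (mfderiv (𝓡 2) 𝓘(ℝ, E2) (extChartAt (𝓡 2) y₀) (D.π₁ (D.b y₀))) := by
    rw [D.π₁_b]
    exact (isInvertible_mfderiv_extChartAt (mem_extChartAt_source y₀)).injective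
  refine (injective_iff_map_eq_zero _).2 fun v hv ↦ ?_
  have hv1 : mfderiv (𝓡 2) 𝓘(ℝ, E2) (extChartAt (𝓡 2) y₀) (D.π₁ (D.b y₀)) (D.dπ₁ (D.b y₀) v) = 0 :=
    congrArg Prod.fst hv
  have h2 : D.ζ c y₀ (D.dnrm (D.b y₀) v) = 0 := congrArg Prod.snd hv
  have h1 : D.dπ₁ (D.b y₀) v = 0 := hφinj (hv1.trans (map_zero _).symm)
  have hmem : D.dnrm (D.b y₀) v ∈ D.F y₀ := by rw [D.dnrm_apply]; exact D.Q_apply_mem y₀ _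
  rw [D.ζ_eq_zero_iff hc hmem] at h2
  exact D.eq_zero_of_dπ₁_eq_zero_of_dnrm_eq_zero y₀ v h1 h2

omit [T2Space S] in
/-- The differential of the chart map at the base point is onto (`4 = 2 + 2`). [folklore] -/
theorem surjective_dΞ (hc : D.Q y₀ c ≠ 0) : Surjective (D.dΞ y₀ c) := by
  have hdim : finrank ℝ (TangentSpace (𝓡 4) (D.b y₀)) = finrank ℝ (E2 × E2) := by
    show finrank ℝ (EuclideanSpace ℝ (Fin 4)) = finrank ℝ (E2 × E2)
    rw [Module.finrank_prod, finrank_euclideanSpace_fin, finrank_euclideanSpace_fin]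
  exact (LinearMap.injective_iff_surjective_of_finrank_eq_finrank hdim
    (f := (D.dΞ y₀ c).toLinearMap)).1 (D.injective_dΞ hc)

/-- The differential of the chart map at the base point as a linear isomorphism `ℝ⁴ ≃L ℝ² × ℝ²`.
[folklore] -/
def dΞequiv (hc : D.Q y₀ c ≠ 0) : EuclideanSpace ℝ (Fin 4) ≃L[ℝ] E2 × E2 :=
  ContinuousLinearEquiv.ofBijective (D.dΞ y₀ c) (LinearMap.ker_eq_bot.2 (D.injective_dΞ hc))
    (LinearMap.range_eq_top.2 (D.surjective_dΞ hc))

/-- **The chart map is a local diffeomorphism at the base point** (inverse function theorem on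
manifolds). [cite: LeeSmoothManifolds2013, Thm. 4.5] -/
theorem isLocalDiffeomorphAt_Ξ (hc : D.Q y₀ c ≠ 0) :
    IsLocalDiffeomorphAt (𝓡 4) 𝓘(ℝ, E2 × E2) ∞ (D.Ξ y₀ c) (D.b y₀) :=
  isLocalDiffeomorphAt_of_mfderiv (D.isOpen_Ξdom y₀ c) (D.b_mem_Ξdom hc) (D.contMDiffOn_Ξ y₀ c)
    (by simp) (D.dΞequiv hc) (by rw [(D.hasMFDerivAt_Ξ hc).mfderiv]; rfl)

/-- **A tubular box chart of the surface around `b y₀`**: a frame seed `c`, an open set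
`O ∋ b y₀` inside the chart domain and a smooth inverse `inv` of the chart map `Ξ` realising a
diffeomorphism `O ≅ ball (φ y₀) δ × ball 0 ρ` (and the base ball inside the chart target).
[cite: HirschDT1976, Ch. 4 §5 Thm. 5.2] -/
structure BoxChart (y₀ : S) where
  /-- the frame seed -/
  c : V
  /-- base radius -/
  δ : ℝ
  /-- fibre radius -/
  ρ : ℝ
  /-- the chart domain in `N` -/
  O : Set N
  /-- the inverse chart -/
  inv : E2 × E2 → N
  hc : D.Q y₀ c ≠ 0
  hδ : 0 < δ
  hρ : 0 < ρ
  isOpen_O : IsOpen O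
  O_subset : O ⊆ D.Ξdom y₀ c
  b_mem_O : D.b y₀ ∈ O
  mapsTo_Ξ : MapsTo (D.Ξ y₀ c) O (ball (extChartAt (𝓡 2) y₀ y₀) δ ×ˢ ball 0 ρ)
  mapsTo_inv : MapsTo inv (ball (extChartAt (𝓡 2) y₀ y₀) δ ×ˢ ball 0 ρ) O
  inv_Ξ : ∀ x ∈ O, inv (D.Ξ y₀ c x) = x
  Ξ_inv : ∀ p ∈ ball (extChartAt (𝓡 2) y₀ y₀) δ ×ˢ ball 0 ρ, D.Ξ y₀ c (inv p) = p
  contMDiffOn_inv : ContMDiffOn 𝓘(ℝ, E2 × E2) (𝓡 4) ∞ inv (ball (extChartAt (𝓡 2) y₀ y₀) δ ×ˢ ball 0 ρ)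
  ball_subset_target : ball (extChartAt (𝓡 2) y₀ y₀) δ ⊆ (extChartAt (𝓡 2) y₀).target

/-- **Existence of tubular box charts at every point of the surface.**
[cite: HirschDT1976, Ch. 4 §5 Thm. 5.2] -/
theorem nonempty_boxChart (y₀ : S) : Nonempty (D.BoxChart y₀) := by
  obtain ⟨c, hc⟩ := D.exists_Q_ne_zero y₀
  have hf := D.isLocalDiffeomorphAt_Ξ hc
  set G := hf.localInverse with hG
  set q₀ : E2 := extChartAt (𝓡 2) y₀ y₀ with hq₀
  have hΞb : D.Ξ y₀ c (D.b y₀) = (q₀, 0) := D.Ξ_b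
  have hGb : G (q₀, 0) = D.b y₀ := by
    rw [← hΞb]; exact hf.localInverse_left_inv hf.localInverse_mem_target
  have hsrc : (q₀, (0 : E2)) ∈ G.source := by rw [← hΞb]; exact hf.localInverse_mem_source
  -- the open set of chart points whose inverse lies in the chart domain
  set W : Set (E2 × E2) := G.source ∩ G ⁻¹' D.Ξdom y₀ c with hW
  have hWopen : IsOpen W :=
    hf.localInverse_contMDiffOn.continuousOn.isOpen_inter_preimage G.open_source (D.isOpen_Ξdom y₀ c)
  have hWmem : (q₀, (0 : E2)) ∈ W := ⟨hsrc, by rw [mem_preimage, hGb]; exact D.b_mem_Ξdom hc⟩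
  obtain ⟨ε, hε, hεW⟩ := Metric.isOpen_iff.1 hWopen _ hWmem
  obtain ⟨ε', hε', hε't⟩ := Metric.isOpen_iff.1 (isOpen_extChartAt_target y₀) q₀
    ((extChartAt (𝓡 2) y₀).map_source (mem_extChartAt_source y₀))
  set δ := min ε ε' with hδ
  have hδpos : 0 < δ := lt_min hε hε'
  set box : Set (E2 × E2) := ball q₀ δ ×ˢ ball 0 ε with hbox
  have hboxW : box ⊆ W := by
    rintro ⟨q, z⟩ ⟨hq, hz⟩
    refine hεW ?_
    rw [ball_prod_same q₀ (0 : E2) ε |>.symm]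
    exact ⟨ball_subset_ball (min_le_left _ _) hq, hz⟩
  have hboxopen : IsOpen box := isOpen_ball.prod isOpen_ball
  -- the chart domain
  set O : Set N := (D.Ξdom y₀ c ∩ G.target) ∩ D.Ξ y₀ c ⁻¹' box with hO
  have hOopen : IsOpen O :=
    ((D.contMDiffOn_Ξ y₀ c).mono inter_subset_left).continuousOn.isOpen_inter_preimage
      ((D.isOpen_Ξdom y₀ c).inter G.open_target) hboxopen
  refine ⟨{
      c := c
      δ := δ
      ρ := ε
      O := O
      inv := G
      hc := hc
      hδ := hδpos
      hρ := hε
      isOpen_O := hOopen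
      O_subset := fun x hx ↦ hx.1.1
      b_mem_O := ?_
      mapsTo_Ξ := fun x hx ↦ hx.2
      mapsTo_inv := ?_
      inv_Ξ := ?_
      Ξ_inv := ?_
      contMDiffOn_inv := ?_
      ball_subset_target := ?_ }⟩
  · refine ⟨⟨D.b_mem_Ξdom hc, hf.localInverse_mem_target⟩, ?_⟩
    rw [mem_preimage, hΞb]
    exact ⟨mem_ball_self hδpos, mem_ball_self hε⟩
  · intro p hp
    have hpW := hboxW hp
    have hright : D.Ξ y₀ c (G p) = p := hf.localInverse_right_inv hpW.1
    exact ⟨⟨hpW.2, G.map_source hpW.1⟩, by rw [mem_preimage, hright]; exact hp⟩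
  · intro x hx
    exact hf.localInverse_left_inv hx.1.2
  · intro p hp
    exact hf.localInverse_right_inv (hboxW hp).1
  · exact hf.localInverse_contMDiffOn.mono fun p hp ↦ (hboxW hp).1
  · exact (ball_subset_ball (min_le_right _ _)).trans hε't

namespace BoxChart

variable {D} {y₀ : S} (B : D.BoxChart y₀)

/-- The box `ball (φ y₀) δ × ball 0 ρ` of the chart. [folklore] -/
def box : Set (E2 × E2) := ball (extChartAt (𝓡 2) y₀ y₀) B.δ ×ˢ ball 0 B.ρ

/-- Membership in the box. [folklore] -/
theorem mem_box_iff {p : E2 × E2} :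
    p ∈ B.box ↔ p.1 ∈ ball (extChartAt (𝓡 2) y₀ y₀) B.δ ∧ p.2 ∈ ball (0 : E2) B.ρ := Iff.rfl

/-- The box is open. [folklore] -/
theorem isOpen_box : IsOpen B.box := isOpen_ball.prod isOpen_ball

/-- `inv` maps the box into `O`. [folklore] -/
theorem inv_mem_O {p : E2 × E2} (hp : p ∈ B.box) : B.inv p ∈ B.O := B.mapsTo_inv hp

/-- `Ξ` maps `O` into the box. [folklore] -/
theorem Ξ_mem_box {x : N} (hx : x ∈ B.O) : D.Ξ y₀ B.c x ∈ B.box := B.mapsTo_Ξ hx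

/-- `O ⊆ N₂`. [folklore] -/
theorem O_subset_N₂ : B.O ⊆ D.N₂ := B.O_subset.trans (D.Ξdom_subset_N₂ y₀ B.c)

/-- `O ⊆ N₁`. [folklore] -/
theorem O_subset_N₁ : B.O ⊆ D.N₁ := B.O_subset.trans (D.Ξdom_subset_N₁ y₀ B.c)

/-- `Ξ` is smooth on `O`. [folklore] -/
theorem contMDiffOn_Ξ : ContMDiffOn (𝓡 4) 𝓘(ℝ, E2 × E2) ∞ (D.Ξ y₀ B.c) B.O :=
  (D.contMDiffOn_Ξ y₀ B.c).mono B.O_subset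

/-- **`π₁ ∘ inv = φ⁻¹ ∘ pr₁`**: in the chart the retraction is the projection to the base.
[folklore] -/
theorem π₁_inv {p : E2 × E2} (hp : p ∈ B.box) :
    D.π₁ (B.inv p) = (extChartAt (𝓡 2) y₀).symm p.1 := by
  have h := congrArg Prod.fst (B.Ξ_inv p hp)
  have hsrc : D.π₁ (B.inv p) ∈ (extChartAt (𝓡 2) y₀).source :=
    D.π₁_mem_source_of_mem_Ξdom (B.O_subset (B.inv_mem_O hp))
  rw [← ((extChartAt (𝓡 2) y₀).left_inv hsrc)]
  exact congrArg (extChartAt (𝓡 2) y₀).symm h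

/-- The frame is defined at the feet of the chart points. [folklore] -/
theorem Q_π₁_inv_ne_zero {p : E2 × E2} (hp : p ∈ B.box) : D.Q (D.π₁ (B.inv p)) B.c ≠ 0 :=
  D.Q_π₁_ne_zero_of_mem_Ξdom (B.O_subset (B.inv_mem_O hp))

/-- The frame is defined over the base ball. [folklore] -/
theorem Q_symm_ne_zero {q : E2} (hq : q ∈ ball (extChartAt (𝓡 2) y₀ y₀) B.δ) :
    D.Q ((extChartAt (𝓡 2) y₀).symm q) B.c ≠ 0 := by
  have hp : (q, (0 : E2)) ∈ B.box := ⟨hq, mem_ball_self B.hρ⟩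
  rw [← B.π₁_inv hp]
  exact B.Q_π₁_inv_ne_zero hp

/-- The base ball lies in the chart target. [folklore] -/
theorem symm_mem_source {q : E2} (hq : q ∈ ball (extChartAt (𝓡 2) y₀ y₀) B.δ) :
    (extChartAt (𝓡 2) y₀).symm q ∈ (extChartAt (𝓡 2) y₀).source :=
  (extChartAt (𝓡 2) y₀).map_target (B.ball_subset_target hq)

/-- **`nrm ∘ inv = Fr ∘ pr₂`**: in the chart the normal coordinate is the fibre coordinate read
in the frame. [folklore] -/
theorem nrm_inv {p : E2 × E2} (hp : p ∈ B.box) :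
    D.nrm (B.inv p) = D.Fr B.c ((extChartAt (𝓡 2) y₀).symm p.1) p.2 := by
  have h := congrArg Prod.snd (B.Ξ_inv p hp)
  have key := D.Fr_ζ (B.Q_π₁_inv_ne_zero hp) (D.nrm_mem_F (B.inv p))
  change D.Fr B.c (D.π₁ (B.inv p)) ((D.Ξ y₀ B.c (B.inv p)).2) = D.nrm (B.inv p) at key
  rw [h, B.π₁_inv hp] at key
  exact key.symm

/-- `‖nrm (inv (q, z))‖ = ‖z‖`. [folklore] -/
theorem norm_nrm_inv {p : E2 × E2} (hp : p ∈ B.box) : ‖D.nrm (B.inv p)‖ = ‖p.2‖ := by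
  rw [B.nrm_inv hp, D.norm_Fr (B.Q_symm_ne_zero hp.1)]

/-- **`Θ ∘ inv (q, z) = (φ⁻¹ q, Fr_{φ⁻¹ q} z)`.** [folklore] -/
theorem Θ_inv {p : E2 × E2} (hp : p ∈ B.box) :
    D.Θ (B.inv p) = ((extChartAt (𝓡 2) y₀).symm p.1, D.Fr B.c ((extChartAt (𝓡 2) y₀).symm p.1) p.2) :=
  Prod.ext (B.π₁_inv hp) (B.nrm_inv hp)

/-- `‖nrm x‖ = ‖(Ξ x).2‖` on `O`. [folklore] -/
theorem norm_nrm {x : N} (hx : x ∈ B.O) : ‖D.nrm x‖ = ‖(D.Ξ y₀ B.c x).2‖ := by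
  conv_lhs => rw [← B.inv_Ξ x hx]
  exact B.norm_nrm_inv (B.Ξ_mem_box hx)

/-- `‖nrm x‖ < ρ` on `O`. [folklore] -/
theorem norm_nrm_lt {x : N} (hx : x ∈ B.O) : ‖D.nrm x‖ < B.ρ := by
  rw [B.norm_nrm hx]
  exact mem_ball_zero_iff.1 (B.Ξ_mem_box hx).2

/-- **Every short normal vector over the base ball is realised in the chart**: for `y` with
`φ y ∈ ball (φ y₀) δ` and `w ∈ F y`, `‖w‖ < ρ`, there is `x ∈ O` with `Θ x = (y, w)`. [folklore] -/
theorem exists_mem_O_Θ_eq {y : S} (hy : y ∈ (extChartAt (𝓡 2) y₀).source)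
    (hyδ : extChartAt (𝓡 2) y₀ y ∈ ball (extChartAt (𝓡 2) y₀ y₀) B.δ) {w : V} (hw : w ∈ D.F y)
    (hwρ : ‖w‖ < B.ρ) : ∃ x ∈ B.O, D.Θ x = (y, w) := by
  have hy' : (extChartAt (𝓡 2) y₀).symm (extChartAt (𝓡 2) y₀ y) = y :=
    (extChartAt (𝓡 2) y₀).left_inv hy
  have hne : D.Q y B.c ≠ 0 := by
    have h := B.Q_symm_ne_zero hyδ
    rwa [hy'] at h
  set p : E2 × E2 := (extChartAt (𝓡 2) y₀ y, D.ζ B.c y w) with hp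
  have hpbox : p ∈ B.box := ⟨hyδ, by rw [mem_ball_zero_iff, D.norm_ζ hne hw]; exact hwρ⟩
  refine ⟨B.inv p, B.inv_mem_O hpbox, ?_⟩
  rw [B.Θ_inv hpbox]
  show ((extChartAt (𝓡 2) y₀).symm (extChartAt (𝓡 2) y₀ y),
    D.Fr B.c ((extChartAt (𝓡 2) y₀).symm (extChartAt (𝓡 2) y₀ y)) (D.ζ B.c y w)) = (y, w)
  rw [hy', D.Fr_ζ hne hw]

/-- **The image of the chart domain under `Θ`**: exactly the pairs `(y, w)` with
`φ y ∈ ball (φ y₀) δ` (and `y` in the chart domain), `w ∈ F y`, `‖w‖ < ρ`. [folklore] -/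
theorem mem_image_Θ_iff {p : S × V} :
    p ∈ D.Θ '' B.O ↔ p.1 ∈ (extChartAt (𝓡 2) y₀).source ∧
      extChartAt (𝓡 2) y₀ p.1 ∈ ball (extChartAt (𝓡 2) y₀ y₀) B.δ ∧ p.2 ∈ D.F p.1 ∧ ‖p.2‖ < B.ρ := by
  constructor
  · rintro ⟨x, hx, rfl⟩
    refine ⟨D.π₁_mem_source_of_mem_Ξdom (B.O_subset hx), (B.Ξ_mem_box hx).1, D.nrm_mem_F x,
      B.norm_nrm_lt hx⟩
  · rintro ⟨h1, h2, h3, h4⟩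
    obtain ⟨x, hx, hxeq⟩ := B.exists_mem_O_Θ_eq h1 h2 h3 h4
    exact ⟨x, hx, hxeq⟩

end BoxChart

end Chart


end Setup

end SurfaceTube

end Literature.Geometry.Symplectic
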